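import Summits.ResolutionOfSingularities.ResolutionOfSingularities.Theorems.WildConesCampaignW46HypersurfacesCharTwoCubicForm

/-!
# [OURS · L1 W4.6, rung (ii) at p = 2, EVERY dimension n] THE BLOW-UP SUBSTITUTION IS INJECTIVE ON FORMAL
# POWER SERIES, hence AN ISOLATED DOUBLE POINT NEVER HAS A ZERO (purely square) STRICT TRANSFORM:
# leaving multiplicity two always means reaching a SMOOTH point — over every field of characteristic 2

HONEST FRAMING. Everything here is OURS: theorems about route WildCones' own TYPED point-blow-up dynamics
(`Theorems/WildConesClassicalRegimesDefs.lean`: states `c`, `step i τ c` = blow up the point, chart `u_i`,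
translate by `τ`, delete squares; `MultP` = double point, `Isol` = finite Milnor algebra; the dictionary
`X_i² T = a∘Φ_{i,τ}`). NOTHING here is a statement of the manuscript [Hironaka2017]; no FACT-LIST premise;
AI review is weaker than expert review. Cell res-hironaka (LADDER-RESOLUTION rung L, D-0089), slot W4.6,
seat res-L1-s46-pv-4 (gen 5); host route `WildCones`, crux `ClassicalRegimes`
(stmt-ResolutionOfSingularities-16884; proved).

WHY. Gen 2 proved that a successor of an ORDER-2-CLEANED double state is non-zero
(`ser_step_ne_zero_of_ordP`, p479260: a hyperbolic pair survives or a linear term appears). The exact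
near-point criterion of gen 5 (`…NearLocus.lean`: double successor at `(i, τ)` iff `w·P = 0 ∧ a₃(w) = 0`)
needs the non-vanishing of the successor for EVERY isolated double state, including the pair-free ones
(`e = n`: plane curves `n = 2`, the corank-`n` states) where no quadratic monomial exists. This file
proves it from the INJECTIVITY of `f ↦ f∘Φ_{i,τ}` on `κ⟦X⟧`: `Φ_{i,τ} = Φ_{i,0} ∘ α_τ` with `α_τ` the
unipotent shear `X_s ↦ X_s + τ_s X_i` (an automorphism: the tree's
`FormalCoordChange.subst_ne_zero_of_isUnit_det`) and `Φ_{i,0}` the monomial substitution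
`X^A ↦ X_i^{|A|} X^{A off i}`, injective on exponents. If the cleaned successor vanished, all partials of
the strict transform `T` would vanish (`pderiv_ser_step_eq`), hence all `(∂_m a)∘Φ` (gradient of the
strict transform, `X_mul_pderiv_strict_of_ne` / `X_sq_mul_pderiv_strict_self`), hence all `∂_m a` — and
the Milnor algebra of `c` would be `κ⟦u⟧`, not finite.

WHAT IS PROVED (every `n`, every field; characteristic `2` from `pderiv_strict_eq_zero` on):

* `prod_erase_X_pow_eq_monomial`, `prod_blowFam_zero_pow`, `blowExp_injective`, `coeff_blowExp_subst_blowFam_zero`,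
  `subst_blowFam_zero_ne_zero` — the untranslated chart map `Φ_{i,0}` is a monomial substitution with
  injective exponent map `A ↦ (A off i) + |A|·e_i`, so it kills no non-zero series;
* `subst_blowFam_eq_subst_shear`, `isUnit_det_linMat_shearFam`, `subst_shearFam_ne_zero` —
  `f∘Φ_{i,τ} = (f∘α_τ)∘Φ_{i,0}` with `α_τ` a unipotent linear automorphism;
* `subst_blowFam_ne_zero`, `subst_blowFam_injective` — **`f ↦ f∘Φ_{i,τ}` is injective**;
* `pderiv_eq_zero_of_pderiv_strict_eq_zero` — for `X_i² G = a∘Φ` (char 2): if all `∂_m G = 0` then all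
  `∂_m a = 0`;
* `hypersurface_ser_step_ne_zero` — **an ISOLATED double state has a non-zero cleaned successor in every
  chart at every translation**; `hypersurface_exists_linear_of_not_multP_step` — so if the successor is
  not a double point it has a LINEAR monomial: the visited point is a smooth point of the transform.

References: G.-M. Greuel, G. Pfister, J. Algebra 689 (2026) [GreuelPfister2026] (context); H. Hironaka,
ms. 2017 [Hironaka2017] Th. 16.6 p.84 — role replaced only, under adjudication.
-/

noncomputable section

-- single-problem summit: the doubled namespace component `ResolutionOfSingularities` is forced
set_option linter.dupNamespace false

open scoped BigOperators Classical

open MvPowerSeries IsLocalRing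

open Literature.AlgebraicGeometry.Resolution

namespace Summit.ResolutionOfSingularities.ResolutionOfSingularities.Theorems

namespace CampaignW46.HypersurfacesCharTwo

open WildCones WildCones.MuDropCharTwoOrdP ThreefoldsCharTwo

variable {κ : Type} [Field κ] {n : ℕ}

/-! ## The untranslated chart map `Φ_{i,0}` is an injective monomial substitution -/

/-- [OURS · L1 W4.6] A product of powers of variables is a monomial. [folklore] -/
theorem prod_X_pow_eq_monomial' (S : Finset (Fin n)) (A : Fin n → ℕ) :
    ∏ s ∈ S, (X s : MvPowerSeries (Fin n) κ) ^ (A s) = monomial (∑ s ∈ S, Finsupp.single s (A s)) 1 := by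
  induction S using Finset.induction_on with
  | empty => rw [Finset.prod_empty, Finset.sum_empty]; rfl
  | insert b S hb ih =>
    rw [Finset.prod_insert hb, Finset.sum_insert hb, ih, X_pow_eq, monomial_mul_monomial, one_mul]

/-- [OURS · L1 W4.6] `Σ_{s ≠ i} A_s e_s = A off i`. [folklore] -/
theorem sum_erase_single_eq_erase (i : Fin n) (A : Fin n →₀ ℕ) :
    ∑ s ∈ Finset.univ.erase i, Finsupp.single s (A s) = A.erase i := by
  ext t
  rw [Finsupp.coe_finsetSum, Finset.sum_apply, Finsupp.erase_apply]
  simp only [Finsupp.single_apply]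
  rw [Finset.sum_ite_eq' (Finset.univ.erase i) t (fun s => A s)]
  by_cases ht : t = i
  · rw [if_pos ht, if_neg (by rw [ht]; exact Finset.notMem_erase i _)]
  · rw [if_neg ht, if_pos (Finset.mem_erase.mpr ⟨ht, Finset.mem_univ t⟩)]

/-- [OURS · L1 W4.6] `Π_{s ≠ i} X_s^{A_s}` is the monomial `X^{A off i}`. [folklore] -/
theorem prod_erase_X_pow_eq_monomial (i : Fin n) (A : Fin n →₀ ℕ) :
    ∏ s ∈ Finset.univ.erase i, (X s : MvPowerSeries (Fin n) κ) ^ (A s) = monomial (A.erase i) 1 := by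
  rw [prod_X_pow_eq_monomial', sum_erase_single_eq_erase]

/-- [OURS · L1 W4.6] The untranslated chart map on monomials:
`Φ_{i,0}^A = X^{(A off i) + |A| e_i}`. [folklore] -/
theorem prod_blowFam_zero_pow (i : Fin n) (A : Fin n →₀ ℕ) :
    (A.prod fun s m => ((fun s => if s = i then (X i : MvPowerSeries (Fin n) κ)
      else X i * (X s + C ((0 : Fin n → κ) s))) s) ^ m) =
      monomial (A.erase i + Finsupp.single i A.degree) 1 := by
  rw [prod_blowFam_pow]
  simp only [Pi.zero_apply, map_zero, add_zero]
  rw [prod_erase_X_pow_eq_monomial, X_pow_eq, monomial_mul_monomial, one_mul, add_comm]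

/-- [OURS · L1 W4.6] The exponent map `A ↦ (A off i) + |A| e_i` of `Φ_{i,0}` is injective: off `i` it
is the identity, and `A_i = |A| − Σ_{s≠i} A_s`. [folklore] -/
theorem blowExp_injective (i : Fin n) :
    Function.Injective (fun A : Fin n →₀ ℕ => A.erase i + Finsupp.single i A.degree) := by
  intro A B hAB
  have hoff : ∀ s, s ≠ i → A s = B s := by
    intro s hs
    have h := DFunLike.congr_fun hAB s
    simp only [Finsupp.coe_add, Pi.add_apply, Finsupp.erase_ne hs, Finsupp.single_apply,
      if_neg (Ne.symm hs), add_zero] at h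
    exact h
  have hdeg : A.degree = B.degree := by
    have h := DFunLike.congr_fun hAB i
    simp only [Finsupp.coe_add, Pi.add_apply, Finsupp.erase_same, Finsupp.single_eq_same,
      zero_add] at h
    exact h
  have hsum : ∑ s ∈ Finset.univ.erase i, A s = ∑ s ∈ Finset.univ.erase i, B s :=
    Finset.sum_congr rfl (fun s hs => hoff s (Finset.ne_of_mem_erase hs))
  have hi : A i = B i := by
    rw [Finsupp.degree_eq_sum, Finsupp.degree_eq_sum, ← Finset.add_sum_erase _ _ (Finset.mem_univ i),
      ← Finset.add_sum_erase _ _ (Finset.mem_univ i), hsum] at hdeg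
    exact Nat.add_right_cancel hdeg
  ext s
  by_cases hs : s = i
  · rw [hs]; exact hi
  · exact hoff s hs

/-- [OURS · L1 W4.6] Coefficients are transported along `Φ_{i,0}`:
`[X^{(A off i) + |A| e_i}](f∘Φ_{i,0}) = [X^A] f`. [folklore] -/
theorem coeff_blowExp_subst_blowFam_zero (i : Fin n) (f : MvPowerSeries (Fin n) κ) (A : Fin n →₀ ℕ) :
    coeff (A.erase i + Finsupp.single i A.degree) (subst (fun s => if s = i then
      (X i : MvPowerSeries (Fin n) κ) else X i * (X s + C ((0 : Fin n → κ) s))) f) = coeff A f := by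
  rw [coeff_subst (hasSubst_blowFam i 0), finsum_eq_single _ A]
  · rw [prod_blowFam_zero_pow, coeff_monomial_same, smul_eq_mul, mul_one]
  · intro B hB
    rw [prod_blowFam_zero_pow, coeff_monomial_ne (fun h => hB (blowExp_injective i h).symm), smul_zero]

/-- [OURS · L1 W4.6] **`Φ_{i,0}` kills no non-zero series.** [folklore] -/
theorem subst_blowFam_zero_ne_zero (i : Fin n) {f : MvPowerSeries (Fin n) κ} (hf : f ≠ 0) :
    subst (fun s => if s = i then (X i : MvPowerSeries (Fin n) κ)
      else X i * (X s + C ((0 : Fin n → κ) s))) f ≠ 0 := by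
  intro h0
  apply hf
  ext A
  rw [← coeff_blowExp_subst_blowFam_zero i f A, h0, map_zero, map_zero]

/-! ## The shear `α_τ : X_s ↦ X_s + τ_s X_i` and the factorisation `Φ_{i,τ} = Φ_{i,0} ∘ α_τ` -/

/-- [OURS · L1 W4.6] The shear has zero constant terms. [folklore] -/
theorem constantCoeff_shearFam (i : Fin n) (τ : Fin n → κ) (s : Fin n) :
    constantCoeff ((fun s => if s = i then (X i : MvPowerSeries (Fin n) κ)
      else X s + C (τ s) * X i) s) = 0 := by
  by_cases hs : s = i
  · simp [hs, constantCoeff_X]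
  · simp [hs, constantCoeff_X]

/-- [OURS · L1 W4.6] The shear is substitutable. [folklore] -/
theorem hasSubst_shearFam (i : Fin n) (τ : Fin n → κ) :
    HasSubst (fun s => if s = i then (X i : MvPowerSeries (Fin n) κ)
      else X s + C (τ s) * X i) :=
  hasSubst_of_constantCoeff_zero (constantCoeff_shearFam i τ)

/-- [OURS · L1 W4.6] **`Φ_{i,τ} = Φ_{i,0} ∘ α_τ`**: `f∘Φ_{i,τ} = (f∘α_τ)∘Φ_{i,0}`. [folklore] -/
theorem subst_blowFam_eq_subst_shear (i : Fin n) (τ : Fin n → κ) (f : MvPowerSeries (Fin n) κ) :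
    subst (fun s => if s = i then (X i : MvPowerSeries (Fin n) κ) else X i * (X s + C (τ s))) f =
      subst (fun s => if s = i then (X i : MvPowerSeries (Fin n) κ)
        else X i * (X s + C ((0 : Fin n → κ) s)))
        (subst (fun s => if s = i then (X i : MvPowerSeries (Fin n) κ)
          else X s + C (τ s) * X i) f) := by
  have hΦ0 := hasSubst_blowFam (κ := κ) i 0
  rw [subst_comp_subst_apply (hasSubst_shearFam i τ) hΦ0]
  congr 1
  funext s
  by_cases hs : s = i
  · rw [if_pos hs, if_pos hs, subst_X hΦ0, if_pos rfl]
  · rw [if_neg hs, if_neg hs, subst_add hΦ0, subst_mul hΦ0, subst_C, subst_X hΦ0, subst_X hΦ0,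
      if_neg hs, if_pos rfl, Pi.zero_apply, map_zero, add_zero]
    ring

/-- [OURS · L1 W4.6] The linear part of the shear is unipotent: `(L − 1)² = 0`, so `det L` is a unit.
[folklore] -/
theorem isUnit_det_linMat_shearFam (i : Fin n) (τ : Fin n → κ) :
    IsUnit (FormalCoordChange.linMat (fun s => if s = i then (X i : MvPowerSeries (Fin n) κ)
      else X s + C (τ s) * X i)).det := by
  set M := FormalCoordChange.linMat (fun s => if s = i then (X i : MvPowerSeries (Fin n) κ)
      else X s + C (τ s) * X i) with hM
  have hMst : ∀ s t, M s t = coeff (Finsupp.single t 1) ((fun s => if s = i then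
      (X i : MvPowerSeries (Fin n) κ) else X s + C (τ s) * X i) s) := fun s t => rfl
  -- the off-diagonal entries of `M - 1` live in column `i`, rows `≠ i`
  have hE : ∀ s t, (M - 1) s t ≠ 0 → s ≠ i ∧ t = i := by
    intro s t hst
    rw [Matrix.sub_apply, hMst, Matrix.one_apply] at hst
    dsimp only at hst
    by_cases hs : s = i
    · exfalso; apply hst
      rw [if_pos hs, coeff_index_single_X]
      by_cases hts : t = s
      · rw [if_pos (hts.trans hs), if_pos hts.symm, sub_self]
      · rw [if_neg (fun h => hts (h.trans hs.symm)), if_neg (Ne.symm hts), sub_self]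
    · refine ⟨hs, ?_⟩
      by_contra hti
      apply hst
      rw [if_neg hs, map_add, coeff_index_single_X, coeff_C_mul, coeff_index_single_X, if_neg hti,
        mul_zero, add_zero]
      by_cases hts : t = s
      · rw [if_pos hts, if_pos hts.symm, sub_self]
      · rw [if_neg hts, if_neg (Ne.symm hts), sub_self]
  have hEE : (M - 1) * (M - 1) = 0 := by
    ext s t
    rw [Matrix.mul_apply, Matrix.zero_apply]
    refine Finset.sum_eq_zero fun u _ => ?_
    by_cases hu : (M - 1) u t = 0
    · rw [hu, mul_zero]
    · by_cases hsu : (M - 1) s u = 0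
      · rw [hsu, zero_mul]
      · exact absurd (hE s u hsu).2 (hE u t hu).1
  have hprod : M * (1 - (M - 1)) = 1 := by
    have : M * (1 - (M - 1)) = 1 - (M - 1) * (M - 1) := by noncomm_ring
    rw [this, hEE, sub_zero]
  have hdet := congrArg Matrix.det hprod
  rw [Matrix.det_mul, Matrix.det_one] at hdet
  exact IsUnit.of_mul_eq_one _ hdet

/-- [OURS · L1 W4.6] The shear kills no non-zero series (it is an automorphism). [folklore] -/
theorem subst_shearFam_ne_zero (i : Fin n) (τ : Fin n → κ) {f : MvPowerSeries (Fin n) κ} (hf : f ≠ 0) :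
    subst (fun s => if s = i then (X i : MvPowerSeries (Fin n) κ)
      else X s + C (τ s) * X i) f ≠ 0 :=
  FormalCoordChange.subst_ne_zero_of_isUnit_det (constantCoeff_shearFam i τ)
    (isUnit_det_linMat_shearFam i τ) hf

/-! ## Injectivity of `f ↦ f∘Φ_{i,τ}` -/

/-- [OURS · L1 W4.6; NOT a statement of the manuscript] **THE BLOW-UP SUBSTITUTION KILLS NO NON-ZERO
SERIES**: `f ≠ 0 ⇒ f∘Φ_{i,τ} ≠ 0` (`Φ_{i,τ} : X_i ↦ X_i, X_s ↦ X_i (X_s + τ_s)`, any field).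
[folklore] -/
theorem subst_blowFam_ne_zero (i : Fin n) (τ : Fin n → κ) {f : MvPowerSeries (Fin n) κ} (hf : f ≠ 0) :
    subst (fun s => if s = i then (X i : MvPowerSeries (Fin n) κ) else X i * (X s + C (τ s))) f ≠ 0 := by
  rw [subst_blowFam_eq_subst_shear]
  exact subst_blowFam_zero_ne_zero i (subst_shearFam_ne_zero i τ hf)

/-- [OURS · L1 W4.6; NOT a statement of the manuscript] **THE BLOW-UP SUBSTITUTION IS INJECTIVE on
`κ⟦X₁,…,Xₙ⟧`.** [folklore] -/
theorem subst_blowFam_injective (i : Fin n) (τ : Fin n → κ) :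
    Function.Injective (subst (fun s => if s = i then (X i : MvPowerSeries (Fin n) κ)
      else X i * (X s + C (τ s))) : MvPowerSeries (Fin n) κ → MvPowerSeries (Fin n) κ) := by
  intro f g hfg
  by_contra hne
  have h := subst_blowFam_ne_zero i τ (sub_ne_zero.mpr hne)
  rw [← coe_substAlgHom (hasSubst_blowFam i τ), map_sub, coe_substAlgHom, hfg, sub_self] at h
  exact h rfl

/-! ## An isolated double point has a non-zero strict transform -/

/-- [OURS · L1 W4.6] **A strict transform with zero gradient comes from a series with zero gradient**
(characteristic `2`): if `X_i² G = a∘Φ_{i,τ}` and `∂_m G = 0` for all `m`, then `∂_m a = 0` for all `m`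
(`X_i ∂_m G = (∂_m a)∘Φ` off `i`, `X_i² ∂_i G = (∂_i a)∘Φ + Σ (X_s + τ_s) X_i ∂_s G`, and `Φ` is
injective). [folklore] -/
theorem pderiv_eq_zero_of_pderiv_strict_eq_zero [CharP κ 2] (i : Fin n) (τ : Fin n → κ)
    {a G : MvPowerSeries (Fin n) κ}
    (hG : X i ^ 2 * G = subst (fun s => if s = i then (X i : MvPowerSeries (Fin n) κ)
      else X i * (X s + C (τ s))) a)
    (hzero : ∀ m, MvPowerSeries.pderiv m G = 0) (m : Fin n) : MvPowerSeries.pderiv m a = 0 := by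
  have hinj := subst_blowFam_injective (κ := κ) i τ
  have hoff : ∀ m, m ≠ i → MvPowerSeries.pderiv m a = 0 := by
    intro m hm
    apply hinj
    rw [← X_mul_pderiv_strict_of_ne i τ hm hG, hzero m, mul_zero, ← coe_substAlgHom (hasSubst_blowFam i τ),
      map_zero]
  by_cases hm : m = i
  · subst hm
    apply hinj
    have h := X_sq_mul_pderiv_strict_self m τ hG
    rw [hzero m, mul_zero, Finset.sum_eq_zero (fun s _ => by rw [hzero s, mul_zero, mul_zero]),
      add_zero] at h
    rw [← h, ← coe_substAlgHom (hasSubst_blowFam m τ), map_zero]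
  · exact hoff m hm

/-- [OURS · L1 W4.6 rung (ii) at `p = 2`, every dimension; NOT a statement of the manuscript] **AN
ISOLATED DOUBLE POINT NEVER HAS A ZERO STRICT TRANSFORM**: for an isolated double state `c` of
`z² = a(u₁,…,uₙ)` over any field of characteristic `2`, the cleaned successor `step i τ c` is NON-ZERO in
every chart `i` at every translation `τ`. (If it vanished, `T` would be a sum of square monomials, all
`∂_m T = ∂_m (clean T) = 0` by `pderiv_ser_step_eq`, hence all `∂_m a = 0` by the previous theorem, and
the Milnor algebra of `c` would be `κ⟦u⟧`.) Gen 2's `ser_step_ne_zero_of_ordP` needed a hyperbolic pair;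
this covers the pair-free states (`e(c) = n`, e.g. plane curves). [folklore] -/
theorem hypersurface_ser_step_ne_zero [CharP κ 2] (c : (Fin n → ℕ) → κ) (i : Fin n) (τ : Fin n → κ)
    (hM : MultP 2 n κ c) (hI : Isol 2 n κ c) : ser 2 n κ (step 2 n κ i τ c) ≠ 0 := by
  intro h0
  set T : MvPowerSeries (Fin n) κ := (show MvPowerSeries (Fin n) κ from
      fun A : Fin n →₀ ℕ => tr n κ i τ 2 (dv n κ i 2 (bl n κ i (clean 2 n κ c))) ⇑A) with hT
  have hzero : ∀ m, MvPowerSeries.pderiv m T = 0 := by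
    intro m
    rw [hT, ← pderiv_ser_step_eq c i τ hM m, h0, map_zero]
  have hpd : ∀ m, MvPowerSeries.pderiv m (ser 2 n κ c) = 0 :=
    pderiv_eq_zero_of_pderiv_strict_eq_zero i τ (X_pow_mul_serT_eq_subst c i τ hM) hzero
  rw [isol_iff_finite_pderiv] at hI
  have hbot : Ideal.span (Set.range fun s : Fin n => MvPowerSeries.pderiv s (ser 2 n κ c)) =
      Ideal.span (((∅ : Finset (MvPowerSeries (Fin n) κ)) : Set (MvPowerSeries (Fin n) κ))) := by
    rw [Finset.coe_empty, Ideal.span_empty, Ideal.span_eq_bot]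
    rintro x ⟨s, rfl⟩
    exact hpd s
  rw [hbot] at hI
  have hn : 0 < n := Fin.pos i
  exact not_finite_quot_span (n := n) (κ := κ) ∅ (by simp) (by simpa using hn) hI

/-- [OURS · L1 W4.6 rung (ii) at `p = 2`, every dimension; NOT a statement of the manuscript]
**LEAVING MULTIPLICITY TWO MEANS A SMOOTH POINT**: if an isolated double state's successor in chart `i`
at `τ` is not a double point, then the cleaned successor has a LINEAR monomial — the transform
`z² + ℓ(u) + …` is smooth at the visited point; the zero (non-reduced, `z² = 0`) successor never occurs.
[folklore] -/
theorem hypersurface_exists_linear_of_not_multP_step [CharP κ 2] (c : (Fin n → ℕ) → κ) (i : Fin n)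
    (τ : Fin n → κ) (hM : MultP 2 n κ c) (hI : Isol 2 n κ c) (hM' : ¬ MultP 2 n κ (step 2 n κ i τ c)) :
    ∃ A, clean 2 n κ (step 2 n κ i τ c) A ≠ 0 ∧ Finset.sum Finset.univ (fun j => A j) = 1 :=
  exists_linear_of_not_multP (hypersurface_ser_step_ne_zero c i τ hM hI) hM'

end CampaignW46.HypersurfacesCharTwo

end Summit.ResolutionOfSingularities.ResolutionOfSingularities.Theorems

end
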